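import Literature.Analysis.SpecialFunctions.ZhouTripleEllipticIntegralProofs
import HarnessLib

/-!
# Gauss's theorem: the complete elliptic integral through the arithmetic–geometric mean,
# `I(a,b) = π / (2 M(a,b))` and `K(k) = π / (2 M(1, k′))`

Topic `Literature/Analysis/SpecialFunctions` (sequel of the AGM paragraph of
`ZhouTripleEllipticIntegralProofs.lean`, which proves Gauss's invariance
`I((a+b)/2, √(ab)) = I(a,b)` of `I(a,b) = ∫_{(0,∞)} dx/√((x²+a²)(x²+b²))` and the closed form
`I(a,b) = K(1 − b²/a²)/a` in terms of the tree's complete elliptic integral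
`Literature.Probability.RandomPlanarGeometry.ellipticK`, parameter convention). The
arithmetic–geometric mean itself is MATHLIB's `NNReal.agm` (file
`Mathlib/Analysis/SpecialFunctions/ArithmeticGeometricMean.lean`: `agmSequences x y n = (gₙ, aₙ)`,
both components converging to `agm x y`, `agm_pos`, `agm_mul_distrib`); nothing is redefined here.
Everything below is classical (Gauss 1799; Borwein–Borwein, *Pi and the AGM*, Thm 1.1) and PROVED;
no named fact is introduced:

* **Gauss's theorem** `integral_Ioi_agm_eq_pi_div : I(a,b) = π/(2M(a,b))` (`a, b > 0`): `I` is
  constant along the AGM sequence (tree: `integral_Ioi_agm_step`), equals `K(1 − gₙ²/aₙ²)/aₙ`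
  there (tree: `integral_Ioi_agm_eq_ellipticK`), and `K` is continuous at `0` with `K(0) = π/2`
  (tree: `continuousAt_ellipticK`, `ellipticK_zero`); let `n → ∞` — no integrability estimate is
  needed;
* hence `ellipticK_eq_pi_mul_div_agm : K(1 − b²/a²) = πa/(2M(a,b))`,
  `ellipticK_one_sub_sq_eq_pi_div_agm : K(1 − b²) = π/(2M(1,b))` and, in modulus form,
  `completeEllipticK_eq_pi_div_agm : K(k) = π/(2M(1,k′))`, `k′ = √(1−k²)`, `0 < k < 1`
  (Borwein–Borwein, *Pi and the AGM*, Thm 1.1 with (1.2.1)).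

This is the first half of Jacobi's inversion theorem `K(k) = (π/2)ϑ₃(q)²` (sequel
`JacobiThetaAGM.lean`: the squares of the thetanulls `ϑ₃², ϑ₄²` perform the AGM).

## References

* J. M. Borwein, P. B. Borwein, *Pi and the AGM*, Wiley (1987), §1.1 (the AGM), Thm 1.1
  (`∫₀^{π/2} dθ/√(a²cos²θ + b²sin²θ) = π/(2M(a,b))`), §1.2 (Gauss's substitution).
* C. F. Gauss, *Werke* III, 361–403 (1799).
-/

noncomputable section

open Real _root_.MeasureTheory _root_.Set _root_.Filter NNReal
open scoped _root_.Topology NNReal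

namespace Literature.Analysis.SpecialFunctions

open Literature.Probability.RandomPlanarGeometry

/-- `I(a,b) = I(b,a)`. [folklore] -/
theorem integral_Ioi_agm_comm (a b : ℝ) :
    ∫ x in Ioi (0 : ℝ), 1 / Real.sqrt ((x ^ 2 + a ^ 2) * (x ^ 2 + b ^ 2)) =
      ∫ x in Ioi (0 : ℝ), 1 / Real.sqrt ((x ^ 2 + b ^ 2) * (x ^ 2 + a ^ 2)) := by
  congr 1
  funext x
  rw [mul_comm]

/-- The geometric means `gₙ` of Mathlib's AGM sequence are positive for `x, y > 0`. [folklore] -/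
theorem agmSequences_fst_pos {x y : ℝ≥0} (hx : 0 < x) (hy : 0 < y) (n : ℕ) :
    0 < (agmSequences x y n).1 := by
  have h1 : (agmSequences x y 0).1 ≤ (agmSequences x y n).1 :=
    agmSequences_fst_monotone (Nat.zero_le n)
  have h0 : (0 : ℝ≥0) < (agmSequences x y 0).1 := by
    rw [agmSequences_zero]
    exact NNReal.sqrt_pos.mpr (mul_pos hx hy)
  exact h0.trans_le h1

/-- The arithmetic means `aₙ` of Mathlib's AGM sequence are positive for `x, y > 0`. [folklore] -/
theorem agmSequences_snd_pos {x y : ℝ≥0} (hx : 0 < x) (hy : 0 < y) (n : ℕ) :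
    0 < (agmSequences x y n).2 :=
  (agmSequences_fst_pos hx hy n).trans_le (agmSequences_fst_le_snd n n)

/-- **Gauss's AGM theorem** (Borwein–Borwein, *Pi and the AGM*, Thm 1.1, in the form
`I(a,b) = ∫_{(0,∞)} dx/√((x²+a²)(x²+b²))`): for `a, b > 0`, `I(a,b) = π/(2M(a,b))`, `M = agm`.
Proof: `I` is invariant under the AGM step (Gauss's substitution, tree) hence constant along
Mathlib's `agmSequences`, where it equals `K(1 − gₙ²/aₙ²)/aₙ → K(0)/M = π/(2M)`.
[cite: BorweinBorwein1987, Thm 1.1] -/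
theorem integral_Ioi_agm_eq_pi_div {a b : ℝ} (ha : 0 < a) (hb : 0 < b) :
    ∫ x in Ioi (0 : ℝ), 1 / Real.sqrt ((x ^ 2 + a ^ 2) * (x ^ 2 + b ^ 2)) =
      π / (2 * ((a.toNNReal).agm b.toNNReal : ℝ)) := by
  set x : ℝ≥0 := a.toNNReal with hxdef
  set y : ℝ≥0 := b.toNNReal with hydef
  have hx : (x : ℝ) = a := Real.coe_toNNReal a ha.le
  have hy : (y : ℝ) = b := Real.coe_toNNReal b hb.le
  have hx0 : 0 < x := Real.toNNReal_pos.mpr ha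
  have hy0 : 0 < y := Real.toNNReal_pos.mpr hb
  set I : ℝ := ∫ t in Ioi (0 : ℝ), 1 / Real.sqrt ((t ^ 2 + a ^ 2) * (t ^ 2 + b ^ 2)) with hI
  have hg0 : ∀ n, (0 : ℝ) < ((agmSequences x y n).1 : ℝ) := fun n => by
    exact_mod_cast agmSequences_fst_pos hx0 hy0 n
  have ha0 : ∀ n, (0 : ℝ) < ((agmSequences x y n).2 : ℝ) := fun n => by
    exact_mod_cast agmSequences_snd_pos hx0 hy0 n
  -- invariance: `I(aₙ, gₙ) = I(a, b)`
  have hinv : ∀ n : ℕ, ∫ t in Ioi (0 : ℝ), 1 / Real.sqrt ((t ^ 2 + ((agmSequences x y n).2 : ℝ) ^ 2) *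
      (t ^ 2 + ((agmSequences x y n).1 : ℝ) ^ 2)) = I := by
    intro n
    induction n with
    | zero =>
      simp only [agmSequences_zero, NNReal.coe_div, NNReal.coe_add, NNReal.coe_ofNat,
        Real.coe_sqrt, NNReal.coe_mul, hx, hy]
      rw [Real.sq_sqrt (mul_pos ha hb).le]
      exact integral_Ioi_agm_step ha hb
    | succ n ih =>
      rw [agmSequences_succ']
      simp only [NNReal.coe_div, NNReal.coe_add, Real.coe_sqrt, NNReal.coe_mul, NNReal.coe_ofNat]
      rw [Real.sq_sqrt (mul_pos (hg0 n) (ha0 n)).le, integral_Ioi_agm_step (hg0 n) (ha0 n), ← ih]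
      exact integral_Ioi_agm_comm _ _
  -- closed form along the sequence
  have hK : ∀ n : ℕ, I = 1 / ((agmSequences x y n).2 : ℝ) *
      ellipticK (1 - ((agmSequences x y n).1 : ℝ) ^ 2 / ((agmSequences x y n).2 : ℝ) ^ 2) :=
    fun n => by
      rw [← hinv n]
      exact integral_Ioi_agm_eq_ellipticK (ha0 n) (hg0 n)
  -- pass to the limit
  have hM : (0 : ℝ) < (x.agm y : ℝ) := by exact_mod_cast agm_pos hx0 hy0
  have h1 : Tendsto (fun n => ((agmSequences x y n).2 : ℝ)) atTop (𝓝 (x.agm y : ℝ)) :=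
    NNReal.tendsto_coe.mpr tendsto_agmSequences_snd_agm
  have h2 : Tendsto (fun n => ((agmSequences x y n).1 : ℝ)) atTop (𝓝 (x.agm y : ℝ)) :=
    NNReal.tendsto_coe.mpr tendsto_agmSequences_fst_agm
  have hu : Tendsto (fun n => 1 - ((agmSequences x y n).1 : ℝ) ^ 2 /
      ((agmSequences x y n).2 : ℝ) ^ 2) atTop (𝓝 0) := by
    have h3 : Tendsto (fun n => ((agmSequences x y n).1 : ℝ) ^ 2 /
        ((agmSequences x y n).2 : ℝ) ^ 2) atTop (𝓝 ((x.agm y : ℝ) ^ 2 / (x.agm y : ℝ) ^ 2)) :=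
      (h2.pow 2).div (h1.pow 2) (pow_ne_zero 2 hM.ne')
    have h := h3.const_sub 1
    rwa [div_self (pow_ne_zero 2 hM.ne'), sub_self] at h
  have hKlim : Tendsto (fun n => ellipticK (1 - ((agmSequences x y n).1 : ℝ) ^ 2 /
      ((agmSequences x y n).2 : ℝ) ^ 2)) atTop (𝓝 (π / 2)) := by
    have hc : ContinuousAt ellipticK 0 := continuousAt_ellipticK zero_lt_one
    have h := hc.tendsto.comp hu
    rwa [ellipticK_zero] at h
  have hlim : Tendsto (fun n => 1 / ((agmSequences x y n).2 : ℝ) *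
      ellipticK (1 - ((agmSequences x y n).1 : ℝ) ^ 2 / ((agmSequences x y n).2 : ℝ) ^ 2)) atTop
      (𝓝 (1 / (x.agm y : ℝ) * (π / 2))) :=
    (tendsto_const_nhds.div h1 hM.ne').mul hKlim
  have hconst : Tendsto (fun _ : ℕ => I) atTop (𝓝 (1 / (x.agm y : ℝ) * (π / 2))) :=
    hlim.congr fun n => (hK n).symm
  have hval : I = 1 / (x.agm y : ℝ) * (π / 2) := tendsto_nhds_unique tendsto_const_nhds hconst
  rw [hval]
  field_simp

/-- `M(a,b) > 0` as a real number, for `a, b > 0`. [folklore] -/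
theorem agm_toNNReal_pos {a b : ℝ} (ha : 0 < a) (hb : 0 < b) :
    (0 : ℝ) < ((a.toNNReal).agm b.toNNReal : ℝ) := by
  exact_mod_cast agm_pos (Real.toNNReal_pos.mpr ha) (Real.toNNReal_pos.mpr hb)

/-- **`K(1 − b²/a²) = πa/(2M(a,b))`** for `a, b > 0` (parameter form of the tree's `ellipticK`).
[cite: BorweinBorwein1987, Thm 1.1] -/
theorem ellipticK_eq_pi_mul_div_agm {a b : ℝ} (ha : 0 < a) (hb : 0 < b) :
    ellipticK (1 - b ^ 2 / a ^ 2) = π * a / (2 * ((a.toNNReal).agm b.toNNReal : ℝ)) := by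
  have h := integral_Ioi_agm_eq_ellipticK ha hb
  rw [integral_Ioi_agm_eq_pi_div ha hb] at h
  have hM := agm_toNNReal_pos ha hb
  field_simp at h
  field_simp
  linarith

/-- **`K(1 − b²) = π/(2M(1,b))`** for `b > 0`: the complete elliptic integral with complementary
modulus `b` is `π/2` over the AGM of `1` and `b`. [cite: BorweinBorwein1987, Thm 1.1] -/
theorem ellipticK_one_sub_sq_eq_pi_div_agm {b : ℝ} (hb : 0 < b) :
    ellipticK (1 - b ^ 2) = π / (2 * ((1 : ℝ≥0).agm b.toNNReal : ℝ)) := by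
  have h := ellipticK_eq_pi_mul_div_agm one_pos hb
  simpa using h

/-- **Gauss: `K(k) = π/(2M(1,k′))`** in modulus form, `k′ = √(1−k²)`, `0 < k < 1`
(`completeEllipticK k = ∫_{(0,1)} dt/√((1−t²)(1−k²t²))`).
[cite: BorweinBorwein1987, Thm 1.1 and (1.2.1)] -/
theorem completeEllipticK_eq_pi_div_agm {k : ℝ} (hk : k ∈ Ioo (0 : ℝ) 1) :
    completeEllipticK k = π / (2 * ((1 : ℝ≥0).agm (Real.sqrt (1 - k ^ 2)).toNNReal : ℝ)) := by
  have hk2 : 0 < 1 - k ^ 2 := by nlinarith [hk.1, hk.2]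
  have h := ellipticK_one_sub_sq_eq_pi_div_agm (Real.sqrt_pos.mpr hk2)
  rw [Real.sq_sqrt hk2.le, sub_sub_cancel] at h
  rw [completeEllipticK_eq_ellipticK, h]

end Literature.Analysis.SpecialFunctions
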